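import Literature.NumberTheory.Automorphic.TateTruncatedZetaIntegral
import HarnessLib

/-!
# Tate's truncated zeta integral at `s = 1` twisted by a non-trivial idele class character
# (Rogawski's Lemma 7.1.1 (a), zeta-free form)

Topic `NumberTheory/Automorphic`; namespace `Literature.NumberTheory.Automorphic`. THEOREMS ONLY
(no definition, no instance, no notation, no named fact, no `sorry`). Companion of
`TateTruncatedZetaIntegral` (the case `χ = 1`, Lemma 7.1.1 (b)). For a number field `K`, the
self-dual Haar measure `μ` on `𝔸_K`, ANY Haar measure `ν` on `𝕀_K`, an idele class domain `𝓕`,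
`f ∈ 𝒮(𝔸_K)` (`Meyer.schwartzBruhatAdele`), a cut-off `T > 0` and a multiplicative
`χ : 𝕀_K →* ℂ` with `‖χ‖ ≤ 1`, measurable, trivial on `Kˣ` and NON-TRIVIAL on the norm-one ideles
(a witness `y₀`, `‖y₀‖ = 1`, `χ(y₀) ≠ 1` — e.g. `χ = ω_{E/K}` the quadratic character of
`𝕀_K ∕ Kˣ N(𝕀_E)` at a non-norm idele of norm one), Rogawski's integral
[Rogawski1990, §7.1 Lemma 7.1.1]

  `I_T(f, χ) = ∫_{Kˣ\𝕀_K} [ Σ_{a∈Kˣ} f(ax) − ‖x‖⁻¹ 1_{‖x‖<T⁻¹} 𝔉f(0) ] χ(x) ‖x‖ dν(x)`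

converges absolutely and equals, for EVERY `T > 0`,

  `I_T(f, χ) = ∫_{𝓕 ∩ {‖x‖≥1}} Σf(x) χ(x) ‖x‖ dν + ∫_{𝓕 ∩ {‖x‖≥1}} Σ(𝔉f)(x) χ(x⁻¹) dν`

— no `log T`, no `f(0)`, no `𝔉f(0)` term: print's "if `χ` is non-trivial, its value is
`θ(1, χ)`", with `θ(1, χ)` (the value at `s = 1` of the entire continuation of
`θ(s, χ) = ∫ f(a)χ(a)|a|^s d^*a`) in Tate's absolutely convergent unfolded form; the identification
with an L-value is not made here. Route: the pointwise four-piece decomposition of the truncated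
integrand (`tateTruncated_integrand_eq`, Poisson along an idele) multiplied by `χ`; the dual piece
by `x ↦ x⁻¹` and a change of fundamental domain, now with the `Kˣ`-invariant bounded weight `χ`;
and the two `χ = 1` volume terms DIE by the **norm-one translation trick**: for a `Kˣ`-invariant
`φ` with `φ(y₀x) = χ(y₀)φ(x)`, `∫_𝓕 φ dν = ∫_{y₀𝓕} φ dν = χ(y₀) ∫_𝓕 φ dν` (`y₀𝓕` is again an
idele class domain, `ν` is left invariant), so `∫_𝓕 φ = 0` — no disintegration `𝕀_K = 𝕀_K¹ × ℝ_{>0}`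
is used.

* **`setIntegral_eq_zero_of_normOne_mul_left`** — the norm-one translation trick;
* **`integrableOn_and_setIntegral_ideleSum_inv_mul`** — the weighted reflection
  `∫_{𝓕∩{‖x‖<1}} Σg(x⁻¹) w(x) dν = ∫_{𝓕∩{‖x‖≥1}} Σg(x) w(x⁻¹) dν`;
* **`integrableOn_and_setIntegral_tateTruncated_twisted`** — Lemma 7.1.1 (a).

Cell `hodgecm-mathlib`, ENGINE T1 LAW 5 ((L5-i) piece C ∕ (L5-iii-c) [Rogawski1990, Prop. 7.2.2 (c),
7.3.2 (c)]: the `ω_{E/F}`-twisted term after the index-two character sum over `Kˣ N(𝕀_E)∖𝕀_K`).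
HC_CM is proved only modulo the 7 printed citations until rung 0 closes — nothing here bears on a
summit statement.

## References
* [Rogawski1990] J. D. Rogawski, *Automorphic Representations of Unitary Groups in Three
  Variables*, Ann. of Math. Stud. 123 (1990), §7.1 Lemma 7.1.1 (a); §7.2 proof of Prop. 7.2.2.
* [CasselsFrohlichANT1967] J. Tate, *Fourier analysis in number fields and Hecke's
  zeta-functions*, in Cassels–Fröhlich (eds.), *Algebraic Number Theory* (1967), Ch. XV, §4.4,
  proof of Thm. 4.4.1 (the case of a non-trivial quasi-character).
-/

set_option autoImplicit false

noncomputable section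

open MeasureTheory MeasureTheory.Measure NumberField IsDedekindDomain Set Filter
open scoped ENNReal NNReal Classical Pointwise
open Literature.NumberTheory.Automorphic.Meyer

namespace Literature.NumberTheory.Automorphic

variable {K : Type} [Field K] [NumberField K]
  [MeasurableSpace (GaloisRepresentations.ideleGroup K)] [BorelSpace (GaloisRepresentations.ideleGroup K)]
  (ν : Measure (GaloisRepresentations.ideleGroup K)) [ν.IsHaarMeasure]
  {𝓕 : Set (GaloisRepresentations.ideleGroup K)}

/-! ### The norm-one translation trick -/

/-- **The norm-one translation trick.** Let `𝓕` be an idele class domain, `φ` a `Kˣ`-invariant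
function on `𝕀_K` and `y₀` an idele with `φ(y₀ x) = c₀ φ(x)` for all `x`, `c₀ ≠ 1`. Then
`∫_𝓕 φ dν = 0`: indeed `∫_𝓕 φ = ∫_{y₀𝓕} φ` (both are fundamental domains, `φ` is invariant) and
`∫_{y₀𝓕} φ = ∫_𝓕 φ(y₀ ·) = c₀ ∫_𝓕 φ` (left invariance of `ν`). This replaces "the integral of a
non-trivial character over `F*\I_F^1` vanishes" in the proof of Lemma 7.1.1 (a).
[cite: Rogawski1990, §7.1 Lemma 7.1.1 (proof)] -/
theorem setIntegral_eq_zero_of_normOne_mul_left (h𝓕 : IsIdeleClassDomain K 𝓕)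
    {φ : GaloisRepresentations.ideleGroup K → ℂ}
    (hφK : ∀ (k : GaloisRepresentations.principalIdeles K) (x : GaloisRepresentations.ideleGroup K),
      φ (k • x) = φ x)
    (y₀ : GaloisRepresentations.ideleGroup K) {c₀ : ℂ} (hc₀ : c₀ ≠ 1)
    (hy : ∀ x, φ (y₀ * x) = c₀ * φ x) :
    ∫ x in 𝓕, φ x ∂ν = 0 := by
  haveI := secondCountableTopology_ideleGroup K
  haveI : MeasurableMul (GaloisRepresentations.ideleGroup K) := inferInstance
  have h1 : ∫ x in 𝓕, φ x ∂ν = ∫ x in y₀ • 𝓕, φ x ∂ν :=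
    (h𝓕.isFundamentalDomain ν).setIntegral_eq ((h𝓕.smul y₀).isFundamentalDomain ν) hφK
  have h2 : ∫ x in y₀ • 𝓕, φ x ∂ν = c₀ * ∫ x in 𝓕, φ x ∂ν := by
    rw [← integral_indicator (h𝓕.smul y₀).measurableSet, ← integral_indicator h𝓕.measurableSet,
      ← integral_const_mul, ← integral_mul_left_eq_self _ y₀]
    refine integral_congr_ae (ae_of_all _ fun x => ?_)
    show (y₀ • 𝓕).indicator φ (y₀ * x) = c₀ * 𝓕.indicator φ x
    by_cases hx : x ∈ 𝓕
    · have hx' : y₀ * x ∈ y₀ • 𝓕 := Set.smul_mem_smul_set_iff.2 hx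
      rw [indicator_of_mem hx', indicator_of_mem hx, hy]
    · have hx' : y₀ * x ∉ y₀ • 𝓕 := fun h => hx (Set.smul_mem_smul_set_iff.1 h)
      rw [indicator_of_notMem hx', indicator_of_notMem hx, mul_zero]
  have h3 : (1 - c₀) * ∫ x in 𝓕, φ x ∂ν = 0 := by rw [sub_mul, one_mul, ← h2, ← h1, sub_self]
  rcases mul_eq_zero.1 h3 with h | h
  · exact absurd (sub_eq_zero.1 h).symm hc₀
  · exact h

/-! ### The weighted dual piece -/

/-- **The weighted reflection**: for `g ∈ 𝒮(𝔸_K)` and a measurable weight `w` on `𝕀_K` with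
`‖w‖ ≤ 1`, invariant under the principal ideles, `x ↦ Σg(x⁻¹) w(x)` is integrable on
`𝓕 ∩ {‖x‖ < 1}` and `∫_{𝓕 ∩ {‖x‖<1}} Σg(x⁻¹) w(x) dν = ∫_{𝓕 ∩ {‖x‖≥1}} Σg(x) w(x⁻¹) dν`
(inversion invariance of `ν`, the fundamental domain `𝓕⁻¹`, `Kˣ`-invariance of
`1_{‖x‖>1} Σg(x) w(x⁻¹)`, null shell `‖x‖ = 1`).
[cite: CasselsFrohlichANT1967, Ch. XV Thm. 4.4.1 (proof)] -/
theorem integrableOn_and_setIntegral_ideleSum_inv_mul (h𝓕 : IsIdeleClassDomain K 𝓕)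
    {g : AdeleRing (𝓞 K) K → ℂ} (hg : g ∈ schwartzBruhatAdele K)
    {w : GaloisRepresentations.ideleGroup K → ℂ} (hwm : Measurable w) (hwb : ∀ x, ‖w x‖ ≤ 1)
    (hwK : ∀ (k : GaloisRepresentations.principalIdeles K) (x : GaloisRepresentations.ideleGroup K),
      w (k • x) = w x) :
    IntegrableOn (fun x => ideleSum K g x⁻¹ * w x)
        ({x | (IdeleClassGroup.ideleNorm K x : ℝ) < 1} ∩ 𝓕) ν ∧
      ∫ x in {x | (IdeleClassGroup.ideleNorm K x : ℝ) < 1} ∩ 𝓕, ideleSum K g x⁻¹ * w x ∂ν =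
        ∫ x in {x | 1 ≤ (IdeleClassGroup.ideleNorm K x : ℝ)} ∩ 𝓕, ideleSum K g x * w x⁻¹ ∂ν := by
  haveI := secondCountableTopology_ideleGroup K
  haveI := locallyCompactSpace_ideleGroup K
  haveI := t2Space_ideleGroup K
  haveI : MeasurableMul (GaloisRepresentations.ideleGroup K) := inferInstance
  haveI : MeasurableInv (GaloisRepresentations.ideleGroup K) := inferInstance
  haveI : ν.Regular := inferInstance
  haveI : ν.IsInvInvariant := inferInstance
  set L : Set (GaloisRepresentations.ideleGroup K) :=
    {x | (IdeleClassGroup.ideleNorm K x : ℝ) < 1} with hL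
  set G' : Set (GaloisRepresentations.ideleGroup K) :=
    {x | 1 < (IdeleClassGroup.ideleNorm K x : ℝ)} with hG'
  set G : Set (GaloisRepresentations.ideleGroup K) :=
    {x | 1 ≤ (IdeleClassGroup.ideleNorm K x : ℝ)} with hG
  have hcont : Continuous fun x : GaloisRepresentations.ideleGroup K =>
      (IdeleClassGroup.ideleNorm K x : ℝ) :=
    NNReal.continuous_coe.comp (continuous_ideleNorm_holds K)
  have hLm : MeasurableSet L := measurableSet_lt hcont.measurable measurable_const
  have hG'm : MeasurableSet G' := measurableSet_lt measurable_const hcont.measurable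
  have h𝓕m : MeasurableSet 𝓕 := h𝓕.measurableSet
  have hLinv : L⁻¹ = G' := by
    ext x
    rw [Set.mem_inv]
    simp only [hL, hG', mem_setOf_eq, map_inv, NNReal.coe_inv]
    exact inv_lt_one₀ (ideleNorm_real_pos x)
  -- the reflected weight `Sw(y) = Σg(y) w(y⁻¹)`
  set Sw : GaloisRepresentations.ideleGroup K → ℂ := fun y => ideleSum K g y * w y⁻¹ with hSw
  have hH : (L ∩ 𝓕).indicator (fun x => ideleSum K g x⁻¹ * w x) =
      ((G' ∩ 𝓕⁻¹).indicator Sw) ∘ Inv.inv := by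
    funext x
    simp only [Function.comp_apply]
    have hiff : x ∈ L ∩ 𝓕 ↔ x⁻¹ ∈ G' ∩ 𝓕⁻¹ := by
      rw [← hLinv, ← Set.inter_inv, Set.mem_inv, inv_inv]
    by_cases hx : x ∈ L ∩ 𝓕
    · rw [indicator_of_mem hx, indicator_of_mem (hiff.1 hx), hSw]
      simp only [inv_inv]
    · rw [indicator_of_notMem hx, indicator_of_notMem (fun h => hx (hiff.2 h))]
  -- `Sw` is integrable on `G ∩ 𝓕` (bounded weight), hence `1_{G'} Sw` on `𝓕` and on `𝓕⁻¹`
  have hwinv : Measurable fun y : GaloisRepresentations.ideleGroup K => w y⁻¹ := hwm.comp measurable_inv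
  have hSwG : IntegrableOn Sw (G ∩ 𝓕) ν := by
    refine Integrable.bdd_mul (integrableOn_ideleSum ν h𝓕 hg) hwinv.aestronglyMeasurable
      (ae_of_all _ fun y => hwb y⁻¹) |>.congr ?_
    exact ae_of_all _ fun y => mul_comm _ _
  have hsub : G' ∩ 𝓕 ⊆ G ∩ 𝓕 :=
    inter_subset_inter_left _ fun x (hx : 1 < (IdeleClassGroup.ideleNorm K x : ℝ)) =>
      (le_of_lt hx : 1 ≤ (IdeleClassGroup.ideleNorm K x : ℝ))
  have hφ𝓕 : IntegrableOn (G'.indicator Sw) 𝓕 ν := by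
    rw [IntegrableOn, integrable_indicator_iff hG'm, IntegrableOn, Measure.restrict_restrict hG'm]
    exact hSwG.mono_set hsub
  have hinvar : ∀ (k : GaloisRepresentations.principalIdeles K)
      (x : GaloisRepresentations.ideleGroup K), G'.indicator Sw (k • x) = G'.indicator Sw x := by
    intro k x
    obtain ⟨c, hc⟩ := k.2
    have hkx : k • x =
        x * Units.map (algebraMap K (AdeleRing (𝓞 K) K) : K →* AdeleRing (𝓞 K) K) c := by
      rw [Subgroup.smul_def, smul_eq_mul, mul_comm, hc]
    have hnorm : (IdeleClassGroup.ideleNorm K (k • x) : ℝ) = (IdeleClassGroup.ideleNorm K x : ℝ) := by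
      rw [Subgroup.smul_def, smul_eq_mul, map_mul, ideleNorm_principal k.2, one_mul]
    have hmem : (k • x ∈ G') ↔ x ∈ G' := by simp only [hG', mem_setOf_eq, hnorm]
    have hwk : w (k • x)⁻¹ = w x⁻¹ := by
      have : (k • x)⁻¹ = k⁻¹ • x⁻¹ := by
        rw [Subgroup.smul_def, Subgroup.smul_def, smul_eq_mul, smul_eq_mul, mul_inv_rev,
          Subgroup.coe_inv, mul_comm]
      rw [this, hwK]
    by_cases hx : x ∈ G'
    · rw [indicator_of_mem hx, indicator_of_mem (hmem.2 hx), hSw]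
      simp only
      rw [hwk, hkx, ideleSum_mul_principal]
    · rw [indicator_of_notMem hx, indicator_of_notMem (fun h => hx (hmem.1 h))]
  have hφinv : IntegrableOn (G'.indicator Sw) 𝓕⁻¹ ν :=
    ((h𝓕.inv.isFundamentalDomain ν).integrableOn_iff (h𝓕.isFundamentalDomain ν) hinvar).2 hφ𝓕
  have hI : Integrable ((G' ∩ 𝓕⁻¹).indicator Sw) ν := by
    rw [integrable_indicator_iff (hG'm.inter h𝓕m.inv)]
    have h2 := hφinv
    rw [IntegrableOn, integrable_indicator_iff hG'm, IntegrableOn,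
      Measure.restrict_restrict hG'm] at h2
    exact h2
  refine ⟨?_, ?_⟩
  · rw [← integrable_indicator_iff (hLm.inter h𝓕m), hH]
    have h2 : Integrable ((G' ∩ 𝓕⁻¹).indicator Sw)
        (Measure.map (MeasurableEquiv.inv (GaloisRepresentations.ideleGroup K)) ν) := by
      rw [show ((MeasurableEquiv.inv (GaloisRepresentations.ideleGroup K) : _ ≃ᵐ _) : _ → _) =
          Inv.inv from rfl, Measure.map_inv_eq_self]
      exact hI
    exact (integrable_map_equiv _ _).1 h2
  · calc ∫ x in L ∩ 𝓕, ideleSum K g x⁻¹ * w x ∂ν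
        = ∫ x, (L ∩ 𝓕).indicator (fun x => ideleSum K g x⁻¹ * w x) x ∂ν :=
          (integral_indicator (hLm.inter h𝓕m)).symm
      _ = ∫ x, ((G' ∩ 𝓕⁻¹).indicator Sw) x⁻¹ ∂ν := by rw [hH]; rfl
      _ = ∫ x, (G' ∩ 𝓕⁻¹).indicator Sw x ∂ν := integral_inv_eq_self _ ν
      _ = ∫ x in 𝓕⁻¹ ∩ G', Sw x ∂ν := by rw [integral_indicator (hG'm.inter h𝓕m.inv), inter_comm]
      _ = ∫ x in 𝓕⁻¹, G'.indicator Sw x ∂ν := (setIntegral_indicator hG'm).symm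
      _ = ∫ x in 𝓕, G'.indicator Sw x ∂ν :=
          (h𝓕.inv.isFundamentalDomain ν).setIntegral_eq (h𝓕.isFundamentalDomain ν) hinvar
      _ = ∫ x in G' ∩ 𝓕, Sw x ∂ν := by rw [setIntegral_indicator hG'm, inter_comm]
      _ = ∫ x in G ∩ 𝓕, Sw x ∂ν := setIntegral_congr_set (setOf_one_lt_ideleNorm_inter_ae_eq ν h𝓕)

/-! ### Lemma 7.1.1 (a) -/

variable [MeasurableSpace (AdeleRing (𝓞 K) K)] [BorelSpace (AdeleRing (𝓞 K) K)]
  (μ : Measure (AdeleRing (𝓞 K) K)) [μ.IsAddHaarMeasure]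

/-- **Rogawski's Lemma 7.1.1 (a), zeta-free form — the truncated Tate integral twisted by a
character non-trivial on the norm-one ideles.** For the self-dual `μ`, any Haar `ν` on `𝕀_K`, an
idele class domain `𝓕`, `f ∈ 𝒮(𝔸_K)`, `T > 0`, and `χ : 𝕀_K →* ℂ` measurable with `‖χ‖ ≤ 1`,
trivial on `Kˣ` and with `χ(y₀) ≠ 1` for some `‖y₀‖ = 1`:
`x ↦ (Σf(x) − ‖x‖⁻¹ 1_{‖x‖<T⁻¹} 𝔉f(0)) χ(x) ‖x‖` is `ν`-integrable on `𝓕` and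
`∫_𝓕 (Σf(x) − ‖x‖⁻¹ 1_{‖x‖<T⁻¹} 𝔉f(0)) χ(x) ‖x‖ dν
  = ∫_{𝓕∩{‖x‖≥1}} Σf(x) χ(x) ‖x‖ dν + ∫_{𝓕∩{‖x‖≥1}} Σ(𝔉f)(x) χ(x⁻¹) dν`
(independent of `T`; print: "if `χ` is non-trivial, its value is `θ(1, χ)`").
[cite: Rogawski1990, §7.1 Lemma 7.1.1] [cite: CasselsFrohlichANT1967, Ch. XV Thm. 4.4.1 (proof)] -/
theorem integrableOn_and_setIntegral_tateTruncated_twisted (hμ : μ (adeleFundamentalDomain K) = 1)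
    (h𝓕 : IsIdeleClassDomain K 𝓕) {f : AdeleRing (𝓞 K) K → ℂ} (hf : f ∈ schwartzBruhatAdele K)
    {T : ℝ} (hT : 0 < T) (χ : GaloisRepresentations.ideleGroup K →* ℂ) (hχm : Measurable χ)
    (hχb : ∀ x, ‖χ x‖ ≤ 1)
    (hχK : ∀ k ∈ GaloisRepresentations.principalIdeles K, χ k = 1)
    {y₀ : GaloisRepresentations.ideleGroup K} (hy₀ : IdeleClassGroup.ideleNorm K y₀ = 1)
    (hχy₀ : χ y₀ ≠ 1) :
    IntegrableOn (fun x => (ideleSum K f x - ((IdeleClassGroup.ideleNorm K x : ℝ) : ℂ)⁻¹ *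
        {x : GaloisRepresentations.ideleGroup K | (IdeleClassGroup.ideleNorm K x : ℝ) < T⁻¹}.indicator
          (fun _ => adeleFourier K μ f 0) x) * χ x * ((IdeleClassGroup.ideleNorm K x : ℝ) : ℂ)) 𝓕 ν ∧
      ∫ x in 𝓕, (ideleSum K f x - ((IdeleClassGroup.ideleNorm K x : ℝ) : ℂ)⁻¹ *
          {x : GaloisRepresentations.ideleGroup K | (IdeleClassGroup.ideleNorm K x : ℝ) < T⁻¹}.indicator
            (fun _ => adeleFourier K μ f 0) x) * χ x * ((IdeleClassGroup.ideleNorm K x : ℝ) : ℂ) ∂ν =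
        (∫ x in {x | 1 ≤ (IdeleClassGroup.ideleNorm K x : ℝ)} ∩ 𝓕,
            ideleSum K f x * χ x * ((IdeleClassGroup.ideleNorm K x : ℝ) : ℂ) ∂ν) +
          ∫ x in {x | 1 ≤ (IdeleClassGroup.ideleNorm K x : ℝ)} ∩ 𝓕,
            ideleSum K (adeleFourier K μ f) x * χ x⁻¹ ∂ν := by
  -- names
  set L : Set (GaloisRepresentations.ideleGroup K) :=
    {x | (IdeleClassGroup.ideleNorm K x : ℝ) < 1} with hL
  set G : Set (GaloisRepresentations.ideleGroup K) :=
    {x | 1 ≤ (IdeleClassGroup.ideleNorm K x : ℝ)} with hG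
  set LT : Set (GaloisRepresentations.ideleGroup K) :=
    {x | (IdeleClassGroup.ideleNorm K x : ℝ) < T⁻¹} with hLT
  set c : ℂ := adeleFourier K μ f 0 with hc
  have hcont : Continuous fun x : GaloisRepresentations.ideleGroup K =>
      (IdeleClassGroup.ideleNorm K x : ℝ) :=
    NNReal.continuous_coe.comp (continuous_ideleNorm_holds K)
  have hLm : MeasurableSet L := measurableSet_lt hcont.measurable measurable_const
  have hGm : MeasurableSet G := measurableSet_le measurable_const hcont.measurable
  have hχae : ∀ s : Set (GaloisRepresentations.ideleGroup K),
      AEStronglyMeasurable χ (ν.restrict s) := fun s => hχm.aestronglyMeasurable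
  -- invariances of `χ` and of the norm
  have hχsmul : ∀ (k : GaloisRepresentations.principalIdeles K) (x : GaloisRepresentations.ideleGroup K),
      χ (k • x) = χ x := fun k x => by
    rw [Subgroup.smul_def, smul_eq_mul, map_mul, hχK k k.2, one_mul]
  have hNsmul : ∀ (k : GaloisRepresentations.principalIdeles K) (x : GaloisRepresentations.ideleGroup K),
      (IdeleClassGroup.ideleNorm K (k • x) : ℝ) = (IdeleClassGroup.ideleNorm K x : ℝ) := fun k x => by
    rw [Subgroup.smul_def, smul_eq_mul, map_mul, ideleNorm_principal k.2, one_mul]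
  have hNy₀ : ∀ x, (IdeleClassGroup.ideleNorm K (y₀ * x) : ℝ) = (IdeleClassGroup.ideleNorm K x : ℝ) :=
    fun x => by rw [map_mul, hy₀, one_mul]
  -- the four pieces, multiplied by `χ`
  set F1 : GaloisRepresentations.ideleGroup K → ℂ :=
    G.indicator fun x => ideleSum K f x * ((IdeleClassGroup.ideleNorm K x : ℝ) : ℂ) with hF1
  set F2 : GaloisRepresentations.ideleGroup K → ℂ :=
    L.indicator fun x => ideleSum K (adeleFourier K μ f) x⁻¹ with hF2
  set F3 : GaloisRepresentations.ideleGroup K → ℂ :=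
    fun x => L.indicator (fun _ => c) x - LT.indicator (fun _ => c) x with hF3
  set F4 : GaloisRepresentations.ideleGroup K → ℂ :=
    L.indicator fun x => f 0 * ((IdeleClassGroup.ideleNorm K x : ℝ) : ℂ) with hF4
  have hdec : (fun x => (ideleSum K f x - ((IdeleClassGroup.ideleNorm K x : ℝ) : ℂ)⁻¹ *
      LT.indicator (fun _ => c) x) * χ x * ((IdeleClassGroup.ideleNorm K x : ℝ) : ℂ)) =
      fun x => χ x * F1 x + χ x * F2 x + χ x * F3 x - χ x * F4 x := by
    funext x
    rw [mul_right_comm, tateTruncated_integrand_eq μ hμ hf T x]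
    ring
  -- piece 1
  have h1i : Integrable (fun x => χ x * F1 x) (ν.restrict 𝓕) := by
    have h := (integrableOn_ideleSum_mul_ideleNorm ν h𝓕 hf)
    have h' : Integrable F1 (ν.restrict 𝓕) := by
      rw [hF1, integrable_indicator_iff hGm, IntegrableOn, Measure.restrict_restrict hGm]; exact h
    exact h'.bdd_mul (hχae 𝓕) (ae_of_all _ hχb)
  have h1v : ∫ x in 𝓕, χ x * F1 x ∂ν = ∫ x in G ∩ 𝓕,
      ideleSum K f x * χ x * ((IdeleClassGroup.ideleNorm K x : ℝ) : ℂ) ∂ν := by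
    have : (fun x => χ x * F1 x) = G.indicator
        (fun x => ideleSum K f x * χ x * ((IdeleClassGroup.ideleNorm K x : ℝ) : ℂ)) := by
      funext x
      by_cases hx : x ∈ G
      · rw [hF1, indicator_of_mem hx, indicator_of_mem hx]; ring
      · rw [hF1, indicator_of_notMem hx, indicator_of_notMem hx, mul_zero]
    rw [this, setIntegral_indicator hGm, inter_comm]
  -- piece 2 (weighted reflection with `w = χ`)
  have hFS : adeleFourier K μ f ∈ schwartzBruhatAdele K := adeleFourier_mem_schwartzBruhatAdele μ hf
  have h2 := integrableOn_and_setIntegral_ideleSum_inv_mul ν h𝓕 hFS hχm hχb hχsmul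
  have h2i : Integrable (fun x => χ x * F2 x) (ν.restrict 𝓕) := by
    have : (fun x => χ x * F2 x) = L.indicator (fun x => ideleSum K (adeleFourier K μ f) x⁻¹ * χ x) := by
      funext x
      by_cases hx : x ∈ L
      · rw [hF2, indicator_of_mem hx, indicator_of_mem hx, mul_comm]
      · rw [hF2, indicator_of_notMem hx, indicator_of_notMem hx, mul_zero]
    rw [this, integrable_indicator_iff hLm, IntegrableOn, Measure.restrict_restrict hLm]
    exact h2.1
  have h2v : ∫ x in 𝓕, χ x * F2 x ∂ν =
      ∫ x in G ∩ 𝓕, ideleSum K (adeleFourier K μ f) x * χ x⁻¹ ∂ν := by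
    have : (fun x => χ x * F2 x) = L.indicator (fun x => ideleSum K (adeleFourier K μ f) x⁻¹ * χ x) := by
      funext x
      by_cases hx : x ∈ L
      · rw [hF2, indicator_of_mem hx, indicator_of_mem hx, mul_comm]
      · rw [hF2, indicator_of_notMem hx, indicator_of_notMem hx, mul_zero]
    rw [this, setIntegral_indicator hLm, inter_comm, h2.2]
  -- piece 3 (dies)
  have h3 := integrableOn_and_setIntegral_indicator_sub_indicator ν h𝓕 hT c
  have h3i : Integrable (fun x => χ x * F3 x) (ν.restrict 𝓕) :=
    (show Integrable F3 (ν.restrict 𝓕) from h3.1).bdd_mul (hχae 𝓕) (ae_of_all _ hχb)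
  have h3v : ∫ x in 𝓕, χ x * F3 x ∂ν = 0 := by
    refine setIntegral_eq_zero_of_normOne_mul_left ν h𝓕 (fun k x => ?_) y₀ hχy₀ (fun x => ?_)
    · show χ (k • x) * F3 (k • x) = χ x * F3 x
      rw [hχsmul, hF3]
      simp only [hL, hLT, Set.indicator, mem_setOf_eq, hNsmul]
    · show χ (y₀ * x) * F3 (y₀ * x) = χ y₀ * (χ x * F3 x)
      rw [map_mul, hF3]
      simp only [hL, hLT, Set.indicator, mem_setOf_eq, hNy₀]
      ring
  -- piece 4 (dies)
  have h4 := integrableOn_and_setIntegral_ideleNorm_lt_one ν h𝓕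
  have h4i : Integrable (fun x => χ x * F4 x) (ν.restrict 𝓕) := by
    have h' : Integrable F4 (ν.restrict 𝓕) := by
      rw [hF4, integrable_indicator_iff hLm, IntegrableOn, Measure.restrict_restrict hLm]
      exact h4.1.const_mul (f 0)
    exact h'.bdd_mul (hχae 𝓕) (ae_of_all _ hχb)
  have h4v : ∫ x in 𝓕, χ x * F4 x ∂ν = 0 := by
    refine setIntegral_eq_zero_of_normOne_mul_left ν h𝓕 (fun k x => ?_) y₀ hχy₀ (fun x => ?_)
    · show χ (k • x) * F4 (k • x) = χ x * F4 x
      rw [hχsmul, hF4]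
      simp only [hL, Set.indicator, mem_setOf_eq, hNsmul]
    · show χ (y₀ * x) * F4 (y₀ * x) = χ y₀ * (χ x * F4 x)
      rw [map_mul, hF4]
      simp only [hL, Set.indicator, mem_setOf_eq, hNy₀]
      ring
  refine ⟨?_, ?_⟩
  · rw [IntegrableOn, hdec]
    exact ((h1i.add h2i).add h3i).sub h4i
  · rw [hdec, integral_sub (f := fun x => χ x * F1 x + χ x * F2 x + χ x * F3 x)
        (g := fun x => χ x * F4 x) ((h1i.add h2i).add h3i) h4i,
      integral_add (f := fun x => χ x * F1 x + χ x * F2 x) (g := fun x => χ x * F3 x)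
        (h1i.add h2i) h3i,
      integral_add (f := fun x => χ x * F1 x) (g := fun x => χ x * F2 x) h1i h2i,
      h1v, h2v, h3v, h4v]
    ring

end Literature.NumberTheory.Automorphic
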